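import Literature.Computability.Complexity.OnesZeroPadding
import Literature.Computability.Complexity.IPOptimumLeafFP
import Literature.Computability.Complexity.CodeFPBudgets
import Literature.Computability.Complexity.CountingHierarchyProofs
import Literature.Computability.Complexity.NondeterministicProofs
import Literature.Computability.Complexity.CountingHierarchyInter
import HarnessLib

/-!
# Sparse `NP`-hard sets: Mahaney's theorem by left-set pruning

Reproduction (statements **and complete proofs**, over the tree's `TM2` model: `Classes.P`,
`Nondeterministic.NP`, Karp hardness `IsHard`) of two published theorems:

* S. R. Mahaney, *Sparse complete sets for NP: solution of a conjecture of Berman and Hartmanis*,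
  J. Comput. System Sci. **25** (1982) 130–143: if some **sparse** set is `NP`-hard under
  polynomial-time many-one reductions, then `P = NP`
  (`NP_subset_P_of_isHard_of_sparse`, `exists_isHard_sparse_iff`).
  [cite: Mahaney1982, main theorem (sparse NP-hard ⇒ P = NP; theorem number not verified: source not held)]
* M. Ogiwara, O. Watanabe, *Polynomial-time bounded truth-table reducibility of NP sets to sparse
  sets*, SIAM J. Comput. **20** (3) (1991) 471–483: the **left-set technique**; reproduced here in
  its `1`-truth-table instance — if an `NP`-hard set `T` differs from some `D ∈ P` only on a sparse
  set (i.e. `T` is *`P`-close*, Yesha 1983 / Schöning 1986, as recalled in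
  [held: `book:editor1990-algorithms`, p. 266: "A set is P-close if there is a set B ∈ P such that
  the symmetric difference of A and B is sparse"]), then `P = NP`
  (`NP_subset_P_of_isHard_of_sparse_symmDiff`, `exists_isHard_sparse_symmDiff_iff`).
  [cite: OgiwaraWatanabe1991, main theorem (≤ᵖ_btt-hard sparse sets for NP ⇒ P = NP; theorem number not verified: source not held)]

Textbook statements of Mahaney's theorem: [held: `book:kozennd-theory-computation`, Lecture 29,
Thm. 29.2 (pp. 131–132 of the scan)], [held: `paper:arxiv-1902.08299` (Hemaspaandra), p. 10:
definition of sparse sets and the statement]. Kozen's proof goes through Fortune's theorem and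
census functions; the proof below is the left-set (interval self-reduction with pruning) argument,
which needs no census *value*, only a census *bound*.

**Sparseness** is expressed by a cumulative polynomial census: `∃ q, ∀ n, ∃ C : Finset`, `|C| ≤ q n`,
containing every relevant word of length `≤ n`. (For the tree's `IsSparseLanguage` of
`Literature.Barriers.PneNP` — `|L ∩ {0,1}ⁿ| ≤ n^c + c` — such a census exists with
`q = (X+1)(X^c + c)`; that bridge is left to users so that this file stays inside
`Literature/Computability/Complexity`.)

## Proof of `NP_subset_P_of_isHard_of_sparse_symmDiff` (left-set pruning, numeric form)

Let `L ∈ NP` with verifier `R ∈ P` and witness bound `p`. Witnesses are re-coded at the exact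
length `m = p(|x|) + 1` (`1ʲ 0 y`, decoded by `stripOnes ⇂ 1`) and read as little-endian numerals
`v < 2^m` (`natBits`/`bitsToNat`). The **left set**
`LEFT = {⟨⟨x, w⟩, ·⟩ : some accepted exact-length witness y' has val w ≤ val y'}` is in `NP`, so the
hardness of `T` gives `f ∈ FP` with `z ∈ LEFT ↔ f z ∈ T`. For `x ∈ L` let `V` be the largest accepted
witness value; then for `|w| = m`, `⟨x, w⟩ ∈ LEFT ↔ val w ≤ V` — membership of the candidates
`c · 2^e` (`c < 2^j`, `e = m - j`) is the down-set `c ≤ V / 2^e` and is a function of the image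
`u_c = f⟨x, bits(c·2^e)⟩`. Level `j` keeps a duplicate-free list `W` of `≤ 2Q+1` numbers `< 2^j`
containing `V / 2^{m-j}` (`Q` = the census bound at the common query length): the children
`2c, 2c+1` are annotated with `(u_c, [u_c ∈ D])`; **rule 1** keeps, among candidates with equal
images, only the largest (the true prefix `t` is the largest member, and equal images have equal
membership); **rule 2** keeps a `D`-positive candidate only if at most `Q` `D`-positive candidates lie
above it, and a `D`-negative one only if fewer than `Q` `D`-negative candidates lie below it — above
`t`, `D`-positive candidates are non-members, so their now pairwise distinct images lie in
`(D \ T) ∩ {0,1}^{≤N}`, at most `Q` of them; below `t`, `D`-negative candidates are members with images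
in `T \ D`, and `t`'s own image is one more. Hence `t` survives and `|W| ≤ (Q+1) + Q`. After `m` levels
`V ∈ W` and `x ∈ L ↔` some `c ∈ W` codes an accepted witness. All list manipulations are `CodeFP`
bricks (`map`, `filter`, `all`, `foldl` with an explicit polynomial output budget), so the procedure
is in `FP` and `L ∈ P` by `mem_P_of_mem_FP`.

## Main statements

* `leftSet_pruneDup_mem`, `leftSet_pruneDup_inj`, `leftSet_pruneRank_mem`, `leftSet_pruneRank_length`
  — the two pruning rules (order-free, over annotated candidate lists);
* `NP_subset_P_of_isHard_of_sparse_symmDiff` — `T` `NP`-hard, `D ∈ P`, `T △ D` with a polynomial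
  census `⇒ NP ⊆ P` (Ogiwara–Watanabe, `1`-tt case);
* `NP_subset_P_of_isHard_of_sparse` — Mahaney's theorem; `isHard_singleton_nil_of_NP_subset_P` and
  the equivalences `exists_isHard_sparse_iff`, `exists_isHard_sparse_symmDiff_iff` (`… ↔ NP ⊆ P`).
-/

namespace Literature.Computability.Complexity

open _root_.Computability Polynomial CodeFP
open scoped Notation

section Pruning

variable {β : Type} [DecidableEq β]

/-- Injective images: a list with pairwise-distinct images in `C` is no longer than `C`. [folklore] -/
theorem length_le_card_of_image_injOn (l : List (ℕ × β × Bool)) (hl : l.Nodup)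
    (hinj : ∀ a ∈ l, ∀ a' ∈ l, a.2.1 = a'.2.1 → a = a') (C : Finset β)
    (hC : ∀ a ∈ l, a.2.1 ∈ C) : l.length ≤ C.card := by
  calc l.length = (l.map (·.2.1)).length := by simp
    _ = (l.map (·.2.1)).toFinset.card := (List.toFinset_card_of_nodup (hl.map_on hinj)).symm
    _ ≤ C.card := Finset.card_le_card fun b hb => by
        obtain ⟨a, ha, rfl⟩ := List.mem_map.1 (List.mem_toFinset.1 hb)
        exact hC a ha

/-- **Duplicate pruning keeps the threshold.** In a list of triples `(c, u, d)` whose images `u`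
determine the side of the threshold `t` (`hmono`), the triple of `t` survives the rule "drop `a`
if a numerically larger `a'` has the same image". [cite: OgiwaraWatanabe1991, proof of the main theorem (left-set technique; section number not verified: source not held)] -/
theorem leftSet_pruneDup_mem (A : List (ℕ × β × Bool)) (t : ℕ) (a₀ : ℕ × β × Bool)
    (ha₀ : a₀ ∈ A) (ht : a₀.1 = t)
    (hmono : ∀ a ∈ A, ∀ a' ∈ A, a.2.1 = a'.2.1 → (a.1 ≤ t ↔ a'.1 ≤ t)) :
    a₀ ∈ A.filter (fun a => A.all (fun a' => !(decide (a.1 < a'.1) && decide (a'.2.1 = a.2.1)))) := by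
  rw [List.mem_filter, List.all_eq_true]
  refine ⟨ha₀, fun a' ha' => ?_⟩
  have h := hmono a' ha' a₀ ha₀
  cases hlt : decide (a₀.1 < a'.1) with
  | false => simp
  | true =>
    cases heq : decide (a'.2.1 = a₀.2.1) with
    | false => simp
    | true =>
      exfalso
      rw [decide_eq_true_eq] at hlt heq
      have := (h heq).2 (ht ▸ le_rfl)
      omega

/-- After duplicate pruning, equal images have equal numbers. [cite: OgiwaraWatanabe1991, proof of the main theorem (left-set technique; section number not verified: source not held)] -/
theorem leftSet_pruneDup_inj (A : List (ℕ × β × Bool)) :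
    ∀ a ∈ A.filter (fun a => A.all (fun a' => !(decide (a.1 < a'.1) && decide (a'.2.1 = a.2.1)))),
    ∀ a' ∈ A.filter (fun a => A.all (fun a' => !(decide (a.1 < a'.1) && decide (a'.2.1 = a.2.1)))),
      a.2.1 = a'.2.1 → a.1 = a'.1 := by
  intro a ha a' ha' heq
  rw [List.mem_filter, List.all_eq_true] at ha ha'
  rcases lt_trichotomy a.1 a'.1 with h | h | h
  · have := ha.2 a' ha'.1
    simp [h, heq] at this
  · exact h
  · have := ha'.2 a ha.1
    simp [h, heq] at this

/-- **Rank pruning keeps the threshold.** With pairwise-distinct images, distinct numbers, and a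
census set `C` (`|C| ≤ Q`) containing the image of every triple whose `d`-bit disagrees with its
side of the threshold, the triple of `t` is among the `Q` smallest `d = 0` triples or the `Q + 1`
largest `d = 1` triples. [cite: OgiwaraWatanabe1991, proof of the main theorem (left-set technique; section number not verified: source not held)] -/
theorem leftSet_pruneRank_mem (A : List (ℕ × β × Bool)) (Q t : ℕ) (a₀ : ℕ × β × Bool)
    (ha₀ : a₀ ∈ A) (ht : a₀.1 = t) (hnd : (A.map Prod.fst).Nodup)
    (hinj : ∀ a ∈ A, ∀ a' ∈ A, a.2.1 = a'.2.1 → a.1 = a'.1)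
    (C : Finset β) (hCQ : C.card ≤ Q)
    (hC : ∀ a ∈ A, ((a.1 ≤ t) ↔ a.2.2 = false) → a.2.1 ∈ C) :
    a₀ ∈ A.filter (fun a =>
      if a.2.2 then decide ((A.filter (fun a' => a'.2.2 && decide (a.1 < a'.1))).length ≤ Q)
      else decide ((A.filter (fun a' => !a'.2.2 && decide (a'.1 < a.1))).length < Q)) := by
  have hA : A.Nodup := hnd.of_map _
  have hinj' : ∀ a ∈ A, ∀ a' ∈ A, a.2.1 = a'.2.1 → a = a' := fun a ha a' ha' h =>
    List.inj_on_of_nodup_map hnd ha ha' (hinj a ha a' ha' h)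
  rw [List.mem_filter]
  refine ⟨ha₀, ?_⟩
  cases hd : a₀.2.2 with
  | true =>
    simp only [if_true, decide_eq_true_eq]
    refine le_trans ?_ hCQ
    refine length_le_card_of_image_injOn _ (hA.filter _)
      (fun a ha a' ha' h => hinj' a (List.mem_of_mem_filter ha) a' (List.mem_of_mem_filter ha') h) C
      fun a ha => ?_
    rw [List.mem_filter] at ha
    obtain ⟨haA, hpa⟩ := ha
    simp only [Bool.and_eq_true, decide_eq_true_eq] at hpa
    refine hC a haA ⟨fun h => ?_, fun h => ?_⟩
    · omega
    · rw [hpa.1] at h; exact absurd h (by decide)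
  | false =>
    simp only [Bool.false_eq_true, if_false, decide_eq_true_eq]
    have hmem : ∀ a ∈ a₀ :: A.filter (fun a' => !a'.2.2 && decide (a'.1 < a₀.1)), a ∈ A := by
      intro a ha
      rcases List.mem_cons.1 ha with rfl | ha
      · exact ha₀
      · exact List.mem_of_mem_filter ha
    have hnotin : a₀ ∉ A.filter (fun a' => !a'.2.2 && decide (a'.1 < a₀.1)) := by
      intro h
      have := (List.mem_filter.1 h).2
      simp at this
    have hlen := length_le_card_of_image_injOn (a₀ :: A.filter (fun a' => !a'.2.2 && decide (a'.1 < a₀.1)))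
      (List.nodup_cons.2 ⟨hnotin, hA.filter _⟩)
      (fun a ha a' ha' h => hinj' a (hmem a ha) a' (hmem a' ha') h) C (fun a ha => by
        rcases List.mem_cons.1 ha with rfl | ha
        · exact hC _ ha₀ ⟨fun _ => hd, fun _ => ht ▸ le_rfl⟩
        · rw [List.mem_filter] at ha
          obtain ⟨haA, hpa⟩ := ha
          simp only [Bool.and_eq_true, Bool.not_eq_true', decide_eq_true_eq] at hpa
          exact hC a haA ⟨fun _ => hpa.1, fun _ => by omega⟩)
    rw [List.length_cons] at hlen
    rw [ht] at hlen ⊢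
    omega

/-- **Rank pruning is small**: at most `Q + 1` triples with `d = 1` survive. [cite: OgiwaraWatanabe1991, proof of the main theorem (left-set technique; section number not verified: source not held)] -/
theorem leftSet_pruneRank_length_true (A : List (ℕ × β × Bool)) (Q : ℕ) (hnd : (A.map Prod.fst).Nodup) :
    (A.filter (fun a => a.2.2 &&
      decide ((A.filter (fun a' => a'.2.2 && decide (a.1 < a'.1))).length ≤ Q))).length ≤ Q + 1 := by
  have hA : A.Nodup := hnd.of_map _
  by_contra hlt
  rw [not_le] at hlt
  set K := A.filter (fun a => a.2.2 &&
      decide ((A.filter (fun a' => a'.2.2 && decide (a.1 < a'.1))).length ≤ Q)) with hK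
  have hKnd : K.Nodup := hA.filter _
  have hKne : K.toFinset.Nonempty := by
    rw [List.toFinset_nonempty_iff]
    intro h; rw [h] at hlt; simp at hlt
  obtain ⟨amin, hmin, hle⟩ := K.toFinset.exists_min_image (fun a => a.1) hKne
  rw [List.mem_toFinset] at hmin
  have hpmin := (List.mem_filter.1 hmin).2
  simp only [Bool.and_eq_true, decide_eq_true_eq] at hpmin
  have hsub : ∀ a ∈ K.erase amin, a ∈ A.filter (fun a' => a'.2.2 && decide (amin.1 < a'.1)) := by
    intro a ha
    have hne : a ≠ amin := fun h => (List.Nodup.not_mem_erase hKnd) (h ▸ ha)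
    have haK : a ∈ K := List.mem_of_mem_erase ha
    have haA := List.mem_filter.1 haK
    simp only [Bool.and_eq_true, decide_eq_true_eq] at haA
    rw [List.mem_filter]
    refine ⟨haA.1, ?_⟩
    have h2 : amin.1 ≤ a.1 := hle a (List.mem_toFinset.2 haK)
    have h3 : amin.1 ≠ a.1 := fun h =>
      hne (List.inj_on_of_nodup_map hnd haA.1 (List.mem_of_mem_filter hmin) h.symm)
    simp only [haA.2.1, Bool.true_and, decide_eq_true_eq]
    omega
  have hcount := (List.subperm_of_subset (hKnd.erase amin) hsub).length_le
  rw [List.length_erase_of_mem hmin] at hcount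
  omega

/-- **Rank pruning is small**: at most `Q` triples with `d = 0` survive. [cite: OgiwaraWatanabe1991, proof of the main theorem (left-set technique; section number not verified: source not held)] -/
theorem leftSet_pruneRank_length_false (A : List (ℕ × β × Bool)) (Q : ℕ) (hnd : (A.map Prod.fst).Nodup) :
    (A.filter (fun a => !a.2.2 &&
      decide ((A.filter (fun a' => !a'.2.2 && decide (a'.1 < a.1))).length < Q))).length ≤ Q := by
  have hA : A.Nodup := hnd.of_map _
  by_contra hlt
  rw [not_le] at hlt
  set K := A.filter (fun a => !a.2.2 &&
      decide ((A.filter (fun a' => !a'.2.2 && decide (a'.1 < a.1))).length < Q)) with hK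
  have hKnd : K.Nodup := hA.filter _
  have hKne : K.toFinset.Nonempty := by
    rw [List.toFinset_nonempty_iff]
    intro h; rw [h] at hlt; simp at hlt
  obtain ⟨amax, hmax, hle⟩ := K.toFinset.exists_max_image (fun a => a.1) hKne
  rw [List.mem_toFinset] at hmax
  have hpmax := (List.mem_filter.1 hmax).2
  simp only [Bool.and_eq_true, Bool.not_eq_true', decide_eq_true_eq] at hpmax
  have hsub : ∀ a ∈ K.erase amax, a ∈ A.filter (fun a' => !a'.2.2 && decide (a'.1 < amax.1)) := by
    intro a ha
    have hne : a ≠ amax := fun h => (List.Nodup.not_mem_erase hKnd) (h ▸ ha)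
    have haK : a ∈ K := List.mem_of_mem_erase ha
    have haA := List.mem_filter.1 haK
    simp only [Bool.and_eq_true, Bool.not_eq_true', decide_eq_true_eq] at haA
    rw [List.mem_filter]
    refine ⟨haA.1, ?_⟩
    have h2 : a.1 ≤ amax.1 := hle a (List.mem_toFinset.2 haK)
    have h3 : amax.1 ≠ a.1 := fun h =>
      hne (List.inj_on_of_nodup_map hnd haA.1 (List.mem_of_mem_filter hmax) h.symm)
    simp only [haA.2.1, Bool.not_false, Bool.true_and, decide_eq_true_eq]
    omega
  have hcount := (List.subperm_of_subset (hKnd.erase amax) hsub).length_le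
  rw [List.length_erase_of_mem hmax] at hcount
  omega

/-- Counting an `if`-split predicate. [folklore] -/
theorem countP_ite_add {γ : Type} (l : List γ) (c p q : γ → Bool) :
    l.countP (fun a => if c a then p a else q a) =
      l.countP (fun a => c a && p a) + l.countP (fun a => !c a && q a) := by
  induction l with
  | nil => simp
  | cons a l ih =>
    simp only [List.countP_cons, ih]
    cases c a <;> cases p a <;> cases q a <;> simp <;> omega

/-- **Rank pruning is small**: at most `2Q + 1` triples survive. [cite: OgiwaraWatanabe1991, proof of the main theorem (left-set technique; section number not verified: source not held)] -/
theorem leftSet_pruneRank_length (A : List (ℕ × β × Bool)) (Q : ℕ) (hnd : (A.map Prod.fst).Nodup) :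
    (A.filter (fun a =>
      if a.2.2 then decide ((A.filter (fun a' => a'.2.2 && decide (a.1 < a'.1))).length ≤ Q)
      else decide ((A.filter (fun a' => !a'.2.2 && decide (a'.1 < a.1))).length < Q))).length
      ≤ 2 * Q + 1 := by
  have h1 := leftSet_pruneRank_length_true A Q hnd
  have h2 := leftSet_pruneRank_length_false A Q hnd
  rw [← List.countP_eq_length_filter] at h1 h2 ⊢
  rw [countP_ite_add]
  omega

end Pruning

/-- Raw codes of short lists of small numerals are short. [folklore] -/
theorem length_rawE_natE_le (l : List ℕ) (k : ℕ) (h : ∀ c ∈ l, c < 2 ^ k) :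
    (rawE natE l).length ≤ l.length * (2 * k + 2) := by
  rw [length_rawE]
  have := List.sum_le_card_nsmul (l.map fun a => 2 * (natE a).length + 2) (2 * k + 2) (by
    intro x hx
    obtain ⟨c, hc, rfl⟩ := List.mem_map.1 hx
    have : (natE c).length ≤ k := by rw [length_natE]; exact Nat.size_le.2 (h c hc)
    omega)
  simpa using this

/-- **Ogiwara–Watanabe, `1`-truth-table case (contains Mahaney's theorem).** If `T` is `NP`-hard
under Karp reductions, `D ∈ P`, and the words on which `T` and `D` differ (`u ∈ T ↔ u ∉ D`) admit
a polynomial census, then `NP ⊆ P`. Proof: left-set pruning, see the module docstring.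
[cite: OgiwaraWatanabe1991, main theorem (≤ᵖ_btt-hard sparse sets for NP ⇒ P = NP; theorem number not verified: source not held)]
[cite: Mahaney1982, main theorem (sparse NP-hard ⇒ P = NP; theorem number not verified: source not held)] -/
theorem NP_subset_P_of_isHard_of_sparse_symmDiff {T D : Language Bool}
    (hT : IsHard Nondeterministic.NP T) (hD : D ∈ Classes.P)
    (hS : ∃ q : Polynomial ℕ, ∀ n, ∃ C : Finset (List Bool), C.card ≤ q.eval n ∧
      ∀ u, (u ∈ T ↔ u ∉ D) → u.length ≤ n → u ∈ C) :
    Nondeterministic.NP ⊆ Classes.P := by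
  classical
  obtain ⟨q, hq⟩ := hS
  intro L hL
  obtain ⟨R, hR, p, hver⟩ := hL
  have hpolyU : ∀ P : Polynomial ℕ, CodeFP unE unE (fun n => P.eval n) := fun P =>
    ⟨Plumb.polyFn P, Plumb.polyFn_mem_FP P, fun n => by
      rw [Plumb.polyFn_apply, length_unE, unE_eq_ones]⟩
  /- Step 0: witnesses of the exact length `p(|x|) + 1`, front-padded as `1ʲ 0 y`. -/
  obtain ⟨RE, hRE⟩ : ∃ RE : List Bool → List Bool → Bool, RE = fun x y' =>
      (decide (y'.length = p.eval x.length + 1) &&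
        R.boolIndicator (boolPair x ((MWProtocol.stripOnes y').drop 1))) := ⟨_, rfl⟩
  have hRE1 : ∀ x y', RE x y' = true → x ∈ L := by
    intro x y' h
    rw [hRE] at h
    simp only [Bool.and_eq_true, decide_eq_true_eq] at h
    refine (hver x).2 ⟨_, ?_, (Set.mem_iff_boolIndicator _ _).2 h.2⟩
    rcases MWProtocol.eq_replicate_or_exists y' with ⟨hz, hs⟩ | ⟨a, x', hz, hs⟩
    · rw [hs]; simp
    · rw [hs]
      have := congrArg List.length hz
      simp only [List.length_append, List.length_replicate, List.length_cons] at this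
      simp only [List.drop_succ_cons, List.drop_zero]
      omega
  have hRElen : ∀ x y', RE x y' = true → y'.length = p.eval x.length + 1 := by
    intro x y' h
    rw [hRE] at h
    simp only [Bool.and_eq_true, decide_eq_true_eq] at h
    exact h.1
  have hRE2 : ∀ x ∈ L, ∃ y', y'.length = p.eval x.length + 1 ∧ RE x y' = true := by
    intro x hx
    obtain ⟨y, hy, hyR⟩ := (hver x).1 hx
    refine ⟨OnesZeroPad.padTo (p.eval x.length + 1) y, OnesZeroPad.length_padTo (by omega), ?_⟩
    rw [hRE]
    simp only [Bool.and_eq_true, decide_eq_true_eq]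
    refine ⟨OnesZeroPad.length_padTo (by omega), ?_⟩
    rw [OnesZeroPad.padTo, MWProtocol.stripOnes_replicate_append, List.drop_succ_cons, List.drop_zero]
    exact (Set.mem_iff_boolIndicator _ _).1 hyR
  have hREC : CodeFP (pairE strE strE) bitE (fun t => RE t.1 t.2) := by
    have hpay : CodeFP strE strE (fun z => (MWProtocol.stripOnes z).drop 1) :=
      CodeFP.of_fn _ OnesZeroPad.payload_mem_FP fun _ => rfl
    have hRC : CodeFP strE bitE (fun z => R.boolIndicator z) :=
      ⟨fun z => encodeBool (R.boolIndicator z), indicatorFn_mem_FP hR, fun _ => rfl⟩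
    have hm : CodeFP (pairE strE strE) unE (fun t => p.eval t.1.length + 1) :=
      (unSucc.comp ((hpolyU p).comp (strLength.comp (CodeFP.fst _ _))) :)
    have hlen : CodeFP (pairE strE strE) bitE (fun t => decide (t.2.length = p.eval t.1.length + 1)) :=
      ((CodeFP.eq unE_injective).comp ((strLength.comp (CodeFP.snd _ _)).pair hm) :)
    have hXB : CodeFP (pairE strE strE) strE
        (fun t => boolPair t.1 ((MWProtocol.stripOnes t.2).drop 1)) :=
      ((CodeFP.fst _ _).pair (hpay.comp (CodeFP.snd _ _))).recodeOut fun _ => rfl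
    rw [hRE]
    exact hlen.and (hRC.comp hXB)
  /- Step 1: the left set `LEFT` of the exact-length verifier, an `NP` language. -/
  obtain ⟨RL, hRL⟩ : ∃ RL : Language Bool, RL = {w | (RE (boolUnpair (boolUnpair w).1).1 (boolUnpair w).2 &&
      decide (bitsToNat (boolUnpair (boolUnpair w).1).2 ≤ bitsToNat (boolUnpair w).2)) = true} := ⟨_, rfl⟩
  have hRLmem : ∀ w, w ∈ RL ↔ (RE (boolUnpair (boolUnpair w).1).1 (boolUnpair w).2 &&
      decide (bitsToNat (boolUnpair (boolUnpair w).1).2 ≤ bitsToNat (boolUnpair w).2)) = true := fun w => by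
    rw [hRL]; exact Iff.rfl
  have hRLpair : ∀ x u y', boolPair (boolPair x u) y' ∈ RL ↔ RE x y' = true ∧ bitsToNat u ≤ bitsToNat y' := by
    intro x u y'
    simp only [hRLmem, boolUnpair_boolPair, Bool.and_eq_true, decide_eq_true_eq]
  have hRLP : RL ∈ Classes.P := by
    have hU1 : CodeFP strE strE (fun w => (boolUnpair w).1) := ⟨_, boolUnpairFst_mem_FP, fun _ => rfl⟩
    have hU2 : CodeFP strE strE (fun w => (boolUnpair w).2) := ⟨_, boolUnpairSnd_mem_FP, fun _ => rfl⟩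
    have htest : CodeFP strE bitE (fun w => RE (boolUnpair (boolUnpair w).1).1 (boolUnpair w).2 &&
        decide (bitsToNat (boolUnpair (boolUnpair w).1).2 ≤ bitsToNat (boolUnpair w).2)) :=
      ((hREC.comp ((hU1.comp hU1).pair hU2)).and
        (natLe.comp ((strVal.comp (hU2.comp hU1)).pair (strVal.comp hU2))) :)
    obtain ⟨d, hd, hdw⟩ := htest
    refine mem_P_of_mem_FP hd _ fun w => ⟨fun hw => ?_, fun hw => ?_⟩
    · rw [hRLmem] at hw
      have := hdw w
      beta_reduce at this
      rw [hw] at this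
      exact this
    · rw [hRLmem, Bool.not_eq_true] at hw
      have := hdw w
      beta_reduce at this
      rw [hw] at this
      exact this
  obtain ⟨LEFT, hLEFT⟩ : ∃ LEFT : Language Bool,
      LEFT = {z | ∃ y', y'.length ≤ (p + 1).eval z.length ∧ boolPair z y' ∈ RL} := ⟨_, rfl⟩
  have hLEFTmem : ∀ z, z ∈ LEFT ↔ ∃ y', y'.length ≤ (p + 1).eval z.length ∧ boolPair z y' ∈ RL :=
    fun z => by rw [hLEFT]; exact Iff.rfl
  have hLEFTNP : LEFT ∈ Nondeterministic.NP := ⟨RL, hRLP, p + 1, hLEFTmem⟩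
  obtain ⟨f, hf, hfred⟩ := hT LEFT hLEFTNP
  obtain ⟨F, hF⟩ := exists_poly_length_le_of_mem_FP hf
  /- Step 2: the threshold `V x` = the largest accepted witness, and the meaning of `LEFT`. -/
  obtain ⟨m, hm⟩ : ∃ m : List Bool → ℕ, m = fun x => p.eval x.length + 1 := ⟨_, rfl⟩
  obtain ⟨V, hV⟩ : ∃ V : List Bool → ℕ,
      V = fun x => Nat.findGreatest (fun v => RE x (natBits (m x) v) = true) (2 ^ m x - 1) := ⟨_, rfl⟩
  have hVlt : ∀ x, V x < 2 ^ m x := fun x => by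
    rw [hV]
    have := Nat.one_le_two_pow (n := m x)
    exact lt_of_le_of_lt (Nat.findGreatest_le _) (by omega)
  have hmx : ∀ x, m x = p.eval x.length + 1 := fun x => by rw [hm]
  have hVspec : ∀ x ∈ L, RE x (natBits (m x) (V x)) = true := by
    intro x hx
    obtain ⟨y', hy'len, hy'⟩ := hRE2 x hx
    rw [← hmx] at hy'len
    have hP : RE x (natBits (m x) (bitsToNat y')) = true := by
      rw [IPVerifier.natBits_bitsToNat_of_length _ hy'len]; exact hy'
    have hb : bitsToNat y' ≤ 2 ^ m x - 1 := by
      have := bitsToNat_lt y'; rw [hy'len] at this; omega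
    rw [hV]
    exact Nat.findGreatest_spec (P := fun v => RE x (natBits (m x) v) = true) hb hP
  -- the meaning of `LEFT` on queries `⟨x, w⟩`, `|w| = m x`
  have hleft : ∀ x ∈ L, ∀ w : List Bool, w.length = m x →
      (boolPair x w ∈ LEFT ↔ bitsToNat w ≤ V x) := by
    intro x hx w hw
    rw [hLEFTmem]
    constructor
    · rintro ⟨y', -, hy'⟩
      obtain ⟨hy'RE, hle⟩ := (hRLpair x w y').1 hy'
      have hy'len : y'.length = m x := by rw [hmx]; exact hRElen x y' hy'RE
      have hP : RE x (natBits (m x) (bitsToNat y')) = true := by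
        rw [IPVerifier.natBits_bitsToNat_of_length _ hy'len]; exact hy'RE
      have hb : bitsToNat y' ≤ 2 ^ m x - 1 := by
        have := bitsToNat_lt y'; rw [hy'len] at this; omega
      have := Nat.le_findGreatest (P := fun v => RE x (natBits (m x) v) = true) hb hP
      rw [hV]
      exact hle.trans this
    · intro hle
      refine ⟨natBits (m x) (V x), ?_, (hRLpair x w _).2 ⟨hVspec x hx, ?_⟩⟩
      · rw [length_natBits, eval_add, eval_one, hmx, length_boolPair]
        have := TM2Iter.eval_mono p (show x.length ≤ 2 * x.length + 2 + w.length by omega)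
        omega
      · rwa [bitsToNat_natBits (hVlt x)]
  /- Step 3: one level of the pruned self-reduction tree and its invariant. -/
  obtain ⟨Q, hQ⟩ : ∃ Q : List Bool → ℕ,
      Q = fun x => q.eval (F.eval (boolPair x (natBits (m x) 0)).length) := ⟨_, rfl⟩
  obtain ⟨img, himg⟩ : ∃ img : List Bool → ℕ → ℕ → List Bool,
      img = fun x e c => f (boolPair x (natBits (m x) (c * 2 ^ e))) := ⟨_, rfl⟩
  obtain ⟨children, hchildren⟩ : ∃ children : List ℕ → List ℕ,
      children = fun W => W.flatMap fun c => [2 * c, 2 * c + 1] := ⟨_, rfl⟩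
  obtain ⟨annot, hannot⟩ : ∃ annot : List Bool → ℕ → List ℕ → List (ℕ × List Bool × Bool),
      annot = fun x e W => W.map fun c => (c, img x e c, D.boolIndicator (img x e c)) := ⟨_, rfl⟩
  obtain ⟨pruneDup, hpruneDup⟩ : ∃ pruneDup : List (ℕ × List Bool × Bool) → List (ℕ × List Bool × Bool),
      pruneDup = fun A => A.filter (fun a => A.all (fun a' =>
        !(decide (a.1 < a'.1) && decide (a'.2.1 = a.2.1)))) := ⟨_, rfl⟩
  obtain ⟨pruneRank, hpruneRank⟩ : ∃ pruneRank : ℕ → List (ℕ × List Bool × Bool) →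
      List (ℕ × List Bool × Bool), pruneRank = fun Q A => A.filter (fun a => if a.2.2 then
        decide ((A.filter (fun a' => a'.2.2 && decide (a.1 < a'.1))).length ≤ Q)
        else decide ((A.filter (fun a' => !a'.2.2 && decide (a'.1 < a.1))).length < Q)) := ⟨_, rfl⟩
  obtain ⟨step, hstep⟩ : ∃ step : List Bool → ℕ → List ℕ → List ℕ, step = fun x j W =>
      (pruneRank (Q x) (pruneDup (annot x (m x - 1 - j) (children W)))).map Prod.fst := ⟨_, rfl⟩
  obtain ⟨Dec, hDec⟩ : ∃ Dec : List Bool → Bool, Dec = fun x =>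
      ((List.range (m x)).foldl (fun W j => step x j W) [0]).any fun c => RE x (natBits (m x) c) :=
    ⟨_, rfl⟩
  -- bookkeeping facts
  have hchnd : ∀ W : List ℕ, W.Nodup → (children W).Nodup := by
    intro W hnd
    rw [hchildren]
    refine List.nodup_flatMap.2 ⟨fun c _ => by simp, List.Pairwise.imp (fun {a b} hab => ?_) hnd⟩
    intro c hc1 hc2
    simp only [List.mem_cons, List.not_mem_nil, or_false] at hc1 hc2
    omega
  have hchbd : ∀ (W : List ℕ) k, (∀ c ∈ W, c < 2 ^ k) → ∀ c ∈ children W, c < 2 ^ (k + 1) := by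
    intro W k hbd c hc
    simp only [hchildren, List.mem_flatMap, List.mem_cons, List.not_mem_nil, or_false] at hc
    obtain ⟨c', hc', hc⟩ := hc
    have := hbd c' hc'
    rw [pow_succ]
    omega
  have hchmem : ∀ (W : List ℕ) t, t / 2 ∈ W → t ∈ children W := by
    intro W t ht
    simp only [hchildren, List.mem_flatMap, List.mem_cons, List.not_mem_nil, or_false]
    exact ⟨t / 2, ht, by omega⟩
  have hAfst : ∀ x e W', (annot x e W').map Prod.fst = W' := by
    intro x e W'
    simp only [hannot, List.map_map, Function.comp_def, List.map_id']
  have hAmem : ∀ x e W' a, a ∈ annot x e W' ↔ ∃ c ∈ W', (c, img x e c, D.boolIndicator (img x e c)) = a := by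
    intro x e W' a
    rw [hannot, List.mem_map]
  have hPDsub : ∀ A, List.Sublist (pruneDup A) A := fun A => by
    rw [hpruneDup]; exact List.filter_sublist
  have hPRsub : ∀ Q A, List.Sublist (pruneRank Q A) A := fun Q A => by
    rw [hpruneRank]; exact List.filter_sublist
  -- the size invariant of one step
  have hInv : ∀ x j (W : List ℕ) k, W.Nodup → (∀ c ∈ W, c < 2 ^ k) →
      (step x j W).Nodup ∧ (∀ c ∈ step x j W, c < 2 ^ (k + 1)) ∧
        (step x j W).length ≤ 2 * Q x + 1 := by
    intro x j W k hnd hbd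
    have hA1nd : ((pruneDup (annot x (m x - 1 - j) (children W))).map Prod.fst).Nodup :=
      ((hPDsub _).map Prod.fst).nodup (by rw [hAfst]; exact hchnd W hnd)
    have hA2sub := hPRsub (Q x) (pruneDup (annot x (m x - 1 - j) (children W)))
    simp only [hstep]
    refine ⟨(hA2sub.map Prod.fst).nodup hA1nd, fun c hc => ?_, ?_⟩
    · have : c ∈ (annot x (m x - 1 - j) (children W)).map Prod.fst :=
        ((hA2sub.trans (hPDsub _)).map Prod.fst).subset hc
      rw [hAfst] at this
      exact hchbd W k hbd c this
    · rw [List.length_map]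
      simp only [hpruneRank]
      exact leftSet_pruneRank_length _ _ hA1nd
  -- the invariant along the fold
  have hfold : ∀ x (l : List ℕ), (l.foldl (fun W j => step x j W) [0]).Nodup ∧
      (∀ c ∈ l.foldl (fun W j => step x j W) [0], c < 2 ^ l.length) ∧
      (l.foldl (fun W j => step x j W) [0]).length ≤ 2 * Q x + 1 := by
    intro x l
    induction l using List.reverseRecOn with
    | nil => exact ⟨List.nodup_singleton 0, by simp, by simp⟩
    | append_singleton l a ih =>
      rw [List.foldl_append, List.foldl_cons, List.foldl_nil, List.length_append,
        List.length_singleton]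
      exact hInv x a _ _ ih.1 ih.2.1
  /- Step 4: the threshold's prefix survives every level (Mahaney / Ogiwara–Watanabe pruning). -/
  have hthr : ∀ x ∈ L, ∀ i ≤ m x,
      V x / 2 ^ (m x - i) ∈ (List.range i).foldl (fun W j => step x j W) [0] := by
    intro x hx i
    induction i with
    | zero => intro; simp [Nat.div_eq_of_lt (hVlt x)]
    | succ i ih =>
      intro hi
      have ih := ih (by omega)
      obtain ⟨hWnd, hWbd, -⟩ := hfold x (List.range i)
      rw [List.length_range] at hWbd
      rw [List.range_succ, List.foldl_append, List.foldl_cons, List.foldl_nil]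
      set W := (List.range i).foldl (fun W j => step x j W) [0] with hW
      simp only [hstep]
      rw [show m x - 1 - i = m x - (i + 1) by omega]
      set e := m x - (i + 1) with he
      set t := V x / 2 ^ e with ht
      have htch : t ∈ children W := by
        refine hchmem W t ?_
        have : t / 2 = V x / 2 ^ (m x - i) := by
          rw [ht, Nat.div_div_eq_div_mul, ← pow_succ, show e + 1 = m x - i by omega]
        rwa [this]
      have hcand : ∀ c ∈ children W, (c ≤ t ↔ img x e c ∈ T) := by
        intro c hc
        have hc2 : c < 2 ^ (i + 1) := hchbd W i hWbd c hc
        have hlt : c * 2 ^ e < 2 ^ m x := by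
          calc c * 2 ^ e < 2 ^ (i + 1) * 2 ^ e := (Nat.mul_lt_mul_right (Nat.two_pow_pos e)).2 hc2
            _ = 2 ^ m x := by rw [← pow_add, show i + 1 + e = m x by omega]
        have h1 : img x e c ∈ T ↔ boolPair x (natBits (m x) (c * 2 ^ e)) ∈ LEFT := by
          rw [himg]; exact (hfred _).symm
        rw [h1, hleft x hx _ (length_natBits _ _), bitsToNat_natBits hlt, ht]
        exact Nat.le_div_iff_mul_le (Nat.two_pow_pos e)
      set A := annot x e (children W) with hA
      have hAmem' := hAmem x e (children W)
      have ha₀ : (t, img x e t, D.boolIndicator (img x e t)) ∈ A := (hAmem' _).2 ⟨t, htch, rfl⟩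
      have hmono : ∀ a ∈ A, ∀ a' ∈ A, a.2.1 = a'.2.1 → (a.1 ≤ t ↔ a'.1 ≤ t) := by
        intro a ha a' ha' h
        obtain ⟨c, hc, rfl⟩ := (hAmem' a).1 ha
        obtain ⟨c', hc', rfl⟩ := (hAmem' a').1 ha'
        simp only at h ⊢
        rw [hcand c hc, hcand c' hc', h]
      have ha₁ : (t, img x e t, D.boolIndicator (img x e t)) ∈ pruneDup A := by
        simp only [hpruneDup]
        exact leftSet_pruneDup_mem A t _ ha₀ rfl hmono
      have hA1nd : ((pruneDup A).map Prod.fst).Nodup :=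
        ((hPDsub A).map Prod.fst).nodup (by rw [hA, hAfst]; exact hchnd W hWnd)
      have hinj : ∀ a ∈ pruneDup A, ∀ a' ∈ pruneDup A, a.2.1 = a'.2.1 → a.1 = a'.1 := by
        simp only [hpruneDup]
        exact leftSet_pruneDup_inj A
      obtain ⟨C, hCQ, hC⟩ := hq (F.eval (boolPair x (natBits (m x) 0)).length)
      have hQx : Q x = q.eval (F.eval (boolPair x (natBits (m x) 0)).length) := by rw [hQ]
      have hC' : ∀ a ∈ pruneDup A, ((a.1 ≤ t) ↔ a.2.2 = false) → a.2.1 ∈ C := by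
        intro a ha h
        obtain ⟨c, hc, rfl⟩ := (hAmem' a).1 ((hPDsub A).subset ha)
        simp only at h ⊢
        refine hC _ ?_ ?_
        · rw [← hcand c hc, h]
          exact (Set.notMem_iff_boolIndicator _ _).symm
        · simp only [himg]
          refine (hF _).trans (le_of_eq ?_)
          rw [length_boolPair, length_boolPair, length_natBits, length_natBits]
      have ha₂ : (t, img x e t, D.boolIndicator (img x e t)) ∈ pruneRank (Q x) (pruneDup A) := by
        simp only [hpruneRank]
        exact leftSet_pruneRank_mem _ (Q x) t _ ha₁ rfl hA1nd hinj C (hQx ▸ hCQ) hC'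
      exact List.mem_map.2 ⟨_, ha₂, rfl⟩
  /- Step 5: the decision procedure is correct ... -/
  have hDec1 : ∀ x, Dec x = true → x ∈ L := by
    intro x h
    simp only [hDec, List.any_eq_true] at h
    obtain ⟨c, -, hc⟩ := h
    exact hRE1 x _ hc
  have hDec2 : ∀ x ∈ L, Dec x = true := by
    intro x hx
    simp only [hDec, List.any_eq_true]
    refine ⟨V x, ?_, hVspec x hx⟩
    have := hthr x hx (m x) le_rfl
    simpa using this
  /- ... and polynomial time. -/
  have hDecC : CodeFP strE bitE Dec := by
    have hmC : CodeFP strE unE m := by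
      rw [hm]; exact (unSucc.comp ((hpolyU p).comp strLength) :)
    have hnb : CodeFP (pairE strE natE) strE (fun t => natBits (m t.1) t.2) :=
      IPVerifier.natBitsC.comp₂ (hmC.comp (CodeFP.fst _ _)) (CodeFP.snd _ _)
    have hℓ : CodeFP strE strE (fun x => boolPair x (natBits (m x) 0)) :=
      ((CodeFP.id strE).pair (hnb.comp₂ (CodeFP.id strE) (CodeFP.const strE (0 : ℕ)))).recodeOut
        fun _ => rfl
    have hQC : CodeFP strE natE Q := by
      rw [hQ]
      exact (natOfUn.comp ((hpolyU q).comp ((hpolyU F).comp (strLength.comp hℓ))) :)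
    have hfC : CodeFP strE strE f := ⟨f, hf, fun _ => rfl⟩
    have hDC : CodeFP strE bitE (fun u => D.boolIndicator u) :=
      ⟨fun z => encodeBool (D.boolIndicator z), indicatorFn_mem_FP hD, fun _ => rfl⟩
    have himgC : CodeFP (pairE (pairE strE unE) natE) strE (fun t => img t.1.1 t.1.2 t.2) := by
      rw [himg]
      have hqry : CodeFP (pairE (pairE strE unE) natE) strE
          (fun t => boolPair t.1.1 (natBits (m t.1.1) (t.2 * 2 ^ t.1.2))) :=
        (((CodeFP.fst _ _).fst').pair (hnb.comp₂ ((CodeFP.fst _ _).fst')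
          (natMul.comp₂ (CodeFP.snd _ _) (natPow.comp₂ (CodeFP.const _ (2 : ℕ))
            ((CodeFP.fst _ _).snd'))))).recodeOut fun _ => rfl
      exact (hfC.comp hqry :)
    have hannC : CodeFP (pairE (pairE strE unE) natE) (pairE natE (pairE strE bitE))
        (fun t => (t.2, img t.1.1 t.1.2 t.2, D.boolIndicator (img t.1.1 t.1.2 t.2))) :=
      (CodeFP.snd _ _).pair (himgC.pair (hDC.comp himgC))
    have hannotC : CodeFP (pairE (pairE strE unE) (rawE natE)) (rawE (pairE natE (pairE strE bitE)))
        (fun t => annot t.1.1 t.1.2 t.2) := by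
      rw [hannot]; exact (CodeFP.map hannC :)
    have h2c : CodeFP natE natE (fun c => 2 * c) :=
      natMul.comp₂ (CodeFP.const _ (2 : ℕ)) (CodeFP.id _)
    have hchC : CodeFP (rawE natE) (rawE natE) children := by
      rw [hchildren]
      exact (((flatten natE).comp (map₀ ((rawCons natE).comp₂ h2c
        ((rawSingleton natE).comp (natAdd.comp₂ h2c (CodeFP.const _ (1 : ℕ))))))) :)
    have hinner : CodeFP (pairE (pairE natE (pairE strE bitE)) (pairE natE (pairE strE bitE))) bitE
        (fun r => !(decide (r.1.1 < r.2.1) && decide (r.2.2.1 = r.1.2.1))) :=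
      ((natLt.comp₂ (CodeFP.fst _ _).fst' (CodeFP.snd _ _).fst').and
        ((CodeFP.eq (eα := strE) Function.injective_id).comp₂ (CodeFP.snd _ _).snd'.fst'
          (CodeFP.fst _ _).snd'.fst')).not
    have hpdC : CodeFP (rawE (pairE natE (pairE strE bitE))) (rawE (pairE natE (pairE strE bitE)))
        pruneDup := by
      rw [hpruneDup]
      have hallC : CodeFP (pairE (pairE natE (pairE strE bitE)) (rawE (pairE natE (pairE strE bitE))))
          bitE (fun q => q.2.all (fun a' => !(decide (q.1.1 < a'.1) && decide (a'.2.1 = q.1.2.1)))) :=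
        (CodeFP.all hinner :)
      exact ((CodeFP.filter (hallC.comp₂ (CodeFP.snd _ _) (CodeFP.fst _ _))).comp₂
        (CodeFP.id _) (CodeFP.id _) :)
    have hprC : CodeFP (pairE natE (rawE (pairE natE (pairE strE bitE))))
        (rawE (pairE natE (pairE strE bitE))) (fun q => pruneRank q.1 q.2) := by
      rw [hpruneRank]
      have hcT : CodeFP (pairE (pairE natE (pairE strE bitE)) (rawE (pairE natE (pairE strE bitE))))
          natE (fun q => (q.2.filter (fun a' => a'.2.2 && decide (q.1.1 < a'.1))).length) :=
        (natLength _).comp (CodeFP.filter ((CodeFP.snd _ _).snd'.snd'.and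
          (natLt.comp₂ (CodeFP.fst _ _).fst' (CodeFP.snd _ _).fst')))
      have hcF : CodeFP (pairE (pairE natE (pairE strE bitE)) (rawE (pairE natE (pairE strE bitE))))
          natE (fun q => (q.2.filter (fun a' => !a'.2.2 && decide (a'.1 < q.1.1))).length) :=
        (natLength _).comp (CodeFP.filter ((CodeFP.snd _ _).snd'.snd'.not.and
          (natLt.comp₂ (CodeFP.snd _ _).fst' (CodeFP.fst _ _).fst')))
      have hpredC : CodeFP (pairE (pairE natE (rawE (pairE natE (pairE strE bitE))))
          (pairE natE (pairE strE bitE))) bitE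
          (fun r => if r.2.2.2 then
            decide ((r.1.2.filter (fun a' => a'.2.2 && decide (r.2.1 < a'.1))).length ≤ r.1.1)
            else decide ((r.1.2.filter (fun a' => !a'.2.2 && decide (a'.1 < r.2.1))).length < r.1.1)) :=
        CodeFP.ite (CodeFP.snd _ _).snd'.snd'
          (natLe.comp₂ (hcT.comp₂ (CodeFP.snd _ _) (CodeFP.fst _ _).snd') (CodeFP.fst _ _).fst')
          (natLt.comp₂ (hcF.comp₂ (CodeFP.snd _ _) (CodeFP.fst _ _).snd') (CodeFP.fst _ _).fst')
      exact ((CodeFP.filter hpredC).comp₂ (CodeFP.id _) (CodeFP.snd _ _) :)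
    have heC : CodeFP (pairE strE natE) unE (fun t => m t.1 - 1 - t.2) :=
      (unOfNatMin.comp₂ (hmC.comp (CodeFP.fst _ _))
        (natSub.comp₂ (natSub.comp₂ (natOfUn.comp (hmC.comp (CodeFP.fst _ _)))
          (CodeFP.const _ (1 : ℕ))) (CodeFP.snd _ _))).congr
        fun t => min_eq_left ((Nat.sub_le _ _).trans (Nat.sub_le _ _))
    have hstepC : CodeFP (pairE strE (pairE natE (rawE natE))) (rawE natE)
        (fun t => step t.1 t.2.1 t.2.2) := by
      rw [hstep]
      have hxe : CodeFP (pairE strE (pairE natE (rawE natE))) (pairE strE unE)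
          (fun t => (t.1, m t.1 - 1 - t.2.1)) :=
        (CodeFP.fst _ _).pair (heC.comp₂ (CodeFP.fst _ _) (CodeFP.snd _ _).fst')
      exact ((map₀ (CodeFP.fst natE (pairE strE bitE))).comp (hprC.comp₂ (hQC.comp (CodeFP.fst _ _))
        (hpdC.comp (hannotC.comp₂ hxe (hchC.comp (CodeFP.snd _ _).snd')))) :)
    have hfoldC : CodeFP (pairE strE (rawE natE)) (rawE natE)
        (fun s => s.2.foldl (fun W j => step s.1 j W) [0]) := by
      refine (CodeFP.foldl (init := fun _ => [0]) hstepC (CodeFP.const _ [0])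
        ((2 * (q.comp (F.comp (2 * X + 3 + p))) + 1) * (2 * X + 2)) fun x l₁ l₂ => ?_ :)
      obtain ⟨-, hbd, hlen⟩ := hfold x l₁
      refine (length_rawE_natE_le _ _ hbd).trans ?_
      set N := (pairE strE (rawE natE) (x, l₁ ++ l₂)).length with hN
      have hN' : N = 2 * x.length + 2 + (rawE natE (l₁ ++ l₂)).length := by
        rw [hN, pairE_apply, length_boolPair]; rfl
      have hxN : x.length ≤ N := by omega
      have hl₁N : l₁.length ≤ N := by
        have := length_le_length_rawE natE (l₁ ++ l₂)
        rw [List.length_append] at this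
        omega
      have hQN : Q x ≤ (q.comp (F.comp (2 * X + 3 + p))).eval N := by
        rw [hQ]
        simp only [eval_comp, eval_add, eval_mul, eval_ofNat, eval_X]
        refine TM2Iter.eval_mono q (TM2Iter.eval_mono F ?_)
        rw [length_boolPair, length_natBits, hmx]
        have := TM2Iter.eval_mono p hxN
        omega
      calc (l₁.foldl (fun W j => step x j W) [0]).length * (2 * l₁.length + 2)
          ≤ (2 * Q x + 1) * (2 * N + 2) := Nat.mul_le_mul hlen (by omega)
        _ ≤ _ := by
          simp only [eval_mul, eval_add, eval_ofNat, eval_X, eval_one]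
          exact Nat.mul_le_mul_right _ (by omega)
    have hlevC : CodeFP strE (rawE natE)
        (fun x => (List.range (m x)).foldl (fun W j => step x j W) [0]) :=
      (hfoldC.comp₂ (CodeFP.id _) (urange.comp hmC) :)
    rw [hDec]
    exact ((CodeFP.any (hREC.comp₂ (CodeFP.fst _ _) hnb)).comp₂ (CodeFP.id _) hlevC :)
  obtain ⟨d, hd, hdx⟩ := hDecC
  refine mem_P_of_mem_FP hd _ fun x => ⟨fun hx => ?_, fun hx => ?_⟩
  · have := hdx x
    rw [hDec2 x hx] at this
    exact this
  · have := hdx x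
    cases hDx : Dec x with
    | true => exact absurd (hDec1 x hDx) hx
    | false => rw [hDx] at this; exact this


/-- **Mahaney's theorem** (1982): if a set `T` with a polynomial census (a sparse set) is `NP`-hard
under Karp reductions, then `NP ⊆ P`. The case `D = ∅` of
`NP_subset_P_of_isHard_of_sparse_symmDiff`. [cite: Mahaney1982, main theorem (sparse NP-hard ⇒ P = NP; theorem number not verified: source not held)] -/
theorem NP_subset_P_of_isHard_of_sparse {T : Language Bool} (hT : IsHard Nondeterministic.NP T)
    (hS : ∃ q : Polynomial ℕ, ∀ n, ∃ C : Finset (List Bool), C.card ≤ q.eval n ∧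
      ∀ u ∈ T, u.length ≤ n → u ∈ C) :
    Nondeterministic.NP ⊆ Classes.P := by
  obtain ⟨q, hq⟩ := hS
  refine NP_subset_P_of_isHard_of_sparse_symmDiff hT bot_mem_P ⟨q, fun n => ?_⟩
  obtain ⟨C, hC, hCT⟩ := hq n
  exact ⟨C, hC, fun u hu hlen => hCT u (hu.2 fun h => h) hlen⟩

/-- If `NP ⊆ P` then the one-word language `{ε}` is `NP`-hard: map members of `L ∈ NP = P` to `ε`
and non-members to `1`. [folklore] -/
theorem isHard_singleton_nil_of_NP_subset_P (h : Nondeterministic.NP ⊆ Classes.P) :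
    IsHard Nondeterministic.NP ({u | u = []} : Language Bool) := by
  intro L hL
  have hdec : CodeFP strE bitE (fun z => L.boolIndicator z) :=
    ⟨fun z => encodeBool (L.boolIndicator z), indicatorFn_mem_FP (h hL), fun _ => rfl⟩
  have hg' : CodeFP strE strE (fun a => if L.boolIndicator a then ([] : List Bool) else [true]) :=
    CodeFP.ite hdec (CodeFP.const strE ([] : List Bool)) (CodeFP.const strE [true])
  obtain ⟨g, hg, hgs⟩ := hg'
  refine ⟨g, hg, fun x => ?_⟩
  have hx : g x = if L.boolIndicator x then [] else [true] := hgs x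
  rw [hx]
  change x ∈ L ↔ (if L.boolIndicator x then [] else [true]) = []
  cases hb : L.boolIndicator x with
  | true => exact ⟨fun _ => by simp, fun _ => (Set.mem_iff_boolIndicator L x).2 hb⟩
  | false =>
    refine ⟨fun hxL => ?_, fun h' => by simp at h'⟩
    have := (Set.mem_iff_boolIndicator L x).1 hxL
    rw [hb] at this
    exact absurd this Bool.false_ne_true

/-- **Mahaney's theorem as an equivalence**: some `NP`-hard set has a polynomial census iff
`NP ⊆ P` (the converse direction by the sparse hard set `{ε}`). [cite: Mahaney1982, main theorem (sparse NP-hard ⇒ P = NP; theorem number not verified: source not held)] -/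
theorem exists_isHard_sparse_iff :
    (∃ T : Language Bool, IsHard Nondeterministic.NP T ∧ ∃ q : Polynomial ℕ, ∀ n,
      ∃ C : Finset (List Bool), C.card ≤ q.eval n ∧ ∀ u ∈ T, u.length ≤ n → u ∈ C) ↔
    Nondeterministic.NP ⊆ Classes.P := by
  refine ⟨fun ⟨T, hT, hS⟩ => NP_subset_P_of_isHard_of_sparse hT hS, fun h =>
    ⟨{u | u = []}, isHard_singleton_nil_of_NP_subset_P h, 1, fun n => ⟨{[]}, by simp, ?_⟩⟩⟩
  intro u hu _
  have hu' : u = [] := hu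
  simp [hu']

/-- **Ogiwara–Watanabe (`1`-tt) as an equivalence**: some `NP`-hard set is `P`-close with a
polynomial census of the difference iff `NP ⊆ P`. [cite: OgiwaraWatanabe1991, main theorem (≤ᵖ_btt-hard sparse sets for NP ⇒ P = NP; theorem number not verified: source not held)] -/
theorem exists_isHard_sparse_symmDiff_iff :
    (∃ T D : Language Bool, IsHard Nondeterministic.NP T ∧ D ∈ Classes.P ∧ ∃ q : Polynomial ℕ,
      ∀ n, ∃ C : Finset (List Bool), C.card ≤ q.eval n ∧
        ∀ u, (u ∈ T ↔ u ∉ D) → u.length ≤ n → u ∈ C) ↔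
    Nondeterministic.NP ⊆ Classes.P := by
  refine ⟨fun ⟨T, D, hT, hD, hS⟩ => NP_subset_P_of_isHard_of_sparse_symmDiff hT hD hS, fun h =>
    ⟨{u | u = []}, ⊥, isHard_singleton_nil_of_NP_subset_P h, bot_mem_P, 1, fun n =>
      ⟨{[]}, by simp, ?_⟩⟩⟩
  intro u hu _
  have hu' : u = [] := hu.2 fun h => h
  simp [hu']

end Literature.Computability.Complexity
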